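import Mathlib.Data.Fintype.Vector
import Literature.Computability.Complexity.InteractiveProofs
import Literature.Computability.Complexity.CoinCounting
import Literature.Computability.Complexity.PrivateCoinGames
import HarnessLib

/-!
# Interactive proofs: the private-coin game of a verifier (bridge `IPVerifier` ↔ `PCGame`)

The passage from the machine-level private-coin verifiers `IPVerifier` of `InteractiveProofs.lean`
(Arora–Barak Def. 8.6: coins and messages are bit strings of the lengths fixed by the verifier's
polynomials, prover messages normalised by `List.takeD`, `acceptProb` a `uniformProb` over the
coins) to the information-theoretic games `PCGame R M` of `PrivateCoinGames.lean` (backward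
induction `PCGame.opt`, "no prover beats `opt`", the greedy prover attains it) — the "purely
syntactic bridge" announced in that file's module docstring, needed by the PROOF of the
Goldwasser–Sipser theorem (`Literature.Computability.Complexity.GoldwasserSipser1986_IPk_subset_AMk`)
and by the amplification of `IP[k]`:

* `IPVerifier.vmsg V x m r t` / `vmsgVec` — the verifier's next message normalised to length `m`;
* `IPVerifier.game V x m ℓ : PCGame (List.Vector Bool ℓ) (List.Vector Bool m)` — the game of `V`
  on the input `x` with `ℓ` coins and messages of length `m`;
* `stratOf` (an `IPProver` as a strategy of the game: its messages truncated / padded to length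
  `m`) and `proverOf` (a strategy as an `IPProver`, via `readVec`), `stratOf_proverOf`;
* **`transcriptAux_eq_map_play`** / `transcript_eq_map` / `accepts_iff_game_accept`: the
  interaction of `InteractiveProofs.lean` IS the play of the game (by induction on the messages,
  the flag of `transcriptAux` tracking the parity of the history);
* `optAccept V k x := (V.game x m ℓ).opt k []` at the verifier's own `m = msgLen(|x|)`,
  `ℓ = coins(|x|)`, and the two readings of `PCGame.card_accept_transcript_le_opt` /
  `card_accept_transcript_greedy`: **`acceptProb_le_optAccept_div`** (against every prover
  `Pr_r[V accepts] ≤ optAccept / 2^ℓ`) and **`exists_prover_acceptProb_eq`** (attained), with the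
  corollaries `mul_two_pow_le_optAccept`, `optAccept_le_mul_two_pow`, `optAccept_le_two_pow`.

The `IPVerifier`-namespace unfolding lemmas `transcriptAux_succ_true` / `transcriptAux_succ_false`
/ `transcriptAux_zero_eq` restate `AMasIP.transcriptAux_true_succ` etc. of
`ArthurMerlinGamesIPProofs.lean` (which sits far above this file in the import order); this is
their proper home and the `AMasIP` copies should eventually be retired in their favour.

## References

* S. Arora, B. Barak, *Computational Complexity: A Modern Approach*, CUP 2009, Def. 8.6, §8.1
  (remarks after Lemma 8.7: deterministic provers suffice; the optimum prover).
-/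

noncomputable section

namespace Literature.Computability.Complexity

open _root_.Computability Finset

open scoped Classical

namespace IPVerifier

variable (V : IPVerifier) (x : List Bool) (m ℓ : ℕ)

/-! ### The verifier's message and the game -/

/-- **The verifier's message** after the history `t` with coins `r`, normalised to length `m`
(`a_{i+1} = V(x, r, a₁, …, a_i)`, truncated / padded as in `IPVerifier.transcriptAux`).
[cite: AroraBarakCC2009, Def. 8.6] -/
def vmsg (r : List Bool) (t : List (List Bool)) : List Bool :=
  (V.next (view x r t)).takeD m false

/-- The verifier's message has the normalised length `m`. [cite: AroraBarakCC2009, Def. 8.6] -/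
@[simp] theorem length_vmsg (r : List Bool) (t : List (List Bool)) : (V.vmsg x m r t).length = m :=
  List.takeD_length _ _ _

/-- The verifier's message as a vector of length `m`. [cite: AroraBarakCC2009, Def. 8.6] -/
def vmsgVec (r : List Bool) (t : List (List Bool)) : List.Vector Bool m :=
  ⟨V.vmsg x m r t, V.length_vmsg x m r t⟩

/-- `(vmsgVec …).toList = vmsg …`. [folklore] -/
@[simp] theorem toList_vmsgVec (r : List Bool) (t : List (List Bool)) :
    (V.vmsgVec x m r t).toList = V.vmsg x m r t :=
  rfl

/-- **The private-coin game of `V` on the input `x`** with `ℓ` coins and messages of length `m`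
(the information-theoretic layer `PCGame` of `PrivateCoinGames.lean`): the verifier's next message
is `vmsg`, its verdict is membership of the view `⟨x, ⟨r, messages⟩⟩` in `V.verdict`.
[cite: AroraBarakCC2009, Def. 8.6] -/
def game : PCGame (List.Vector Bool ℓ) (List.Vector Bool m) where
  next r h := V.vmsgVec x m r.toList (h.map List.Vector.toList)
  accept r h := view x r.toList (h.map List.Vector.toList) ∈ V.verdict

/-- The game's next message, as a list. [folklore] -/
@[simp] theorem toList_game_next (r : List.Vector Bool ℓ) (h : List (List.Vector Bool m)) :
    ((V.game x m ℓ).next r h).toList = V.vmsg x m r.toList (h.map List.Vector.toList) :=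
  rfl

/-- The game's verdict. [folklore] -/
theorem game_accept_iff (r : List.Vector Bool ℓ) (h : List (List.Vector Bool m)) :
    (V.game x m ℓ).accept r h ↔ view x r.toList (h.map List.Vector.toList) ∈ V.verdict :=
  Iff.rfl

/-! ### Provers as strategies and back -/

/-- **An `IPProver` as a strategy of the game**: its reply to the history, truncated / padded to
length `m` exactly as `transcriptAux` normalises it. [cite: AroraBarakCC2009, Def. 8.6] -/
def stratOf (P : IPProver) : List (List.Vector Bool m) → List.Vector Bool m :=
  fun h => ⟨(P (h.map List.Vector.toList)).takeD m false, List.takeD_length _ _ _⟩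

/-- A string read as a message of the game: truncated / padded to length `m`. [folklore] -/
def readVec (a : List Bool) : List.Vector Bool m := ⟨a.takeD m false, List.takeD_length _ _ _⟩

/-- `(readVec m a).toList = a.takeD m false`. [folklore] -/
@[simp] theorem toList_readVec (a : List Bool) : (readVec m a).toList = a.takeD m false := rfl

/-- **A strategy of the game as an `IPProver`** (messages of a transcript read back as vectors by
`readVec`, which is the identity on messages of length `m`). [cite: AroraBarakCC2009, Def. 8.6] -/
def proverOf (σ : List (List.Vector Bool m) → List.Vector Bool m) : IPProver :=
  fun t => (σ (t.map (readVec m))).toList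

/-- `takeD m` is the identity on a string of length `m`. [folklore] -/
theorem takeD_of_length_eq {a : List Bool} (ha : a.length = m) : a.takeD m false = a := by
  rw [List.takeD_eq_take _ ha.ge, List.take_of_length_le ha.le]

/-- Reading a vector's list back is the identity. [folklore] -/
@[simp] theorem readVec_toList (a : List.Vector Bool m) : readVec m a.toList = a :=
  List.Vector.eq _ _ (by rw [toList_readVec]; exact takeD_of_length_eq m a.toList_length)

/-- Reading a history of vectors back is the identity. [folklore] -/
theorem map_readVec_map_toList (h : List (List.Vector Bool m)) :
    (h.map List.Vector.toList).map (readVec m) = h := by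
  rw [List.map_map]
  conv_rhs => rw [← List.map_id h]
  exact List.map_congr_left fun a _ => readVec_toList m a

/-- The strategy of the prover of a strategy is the strategy. [folklore] -/
theorem stratOf_proverOf (σ : List (List.Vector Bool m) → List.Vector Bool m) :
    stratOf m (proverOf m σ) = σ := by
  funext h
  refine List.Vector.eq _ _ ?_
  have h1 : proverOf m σ (h.map List.Vector.toList) = (σ h).toList := by
    simp only [proverOf, map_readVec_map_toList]
  show (proverOf m σ (h.map List.Vector.toList)).takeD m false = (σ h).toList
  rw [h1]
  exact takeD_of_length_eq m (σ h).toList_length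

/-! ### The interaction is the play of the game -/

/-- One step of the interaction, the verifier speaking (`IPVerifier`-namespace home of the
unfolding lemma; cf. `AMasIP.transcriptAux_true_succ`). [cite: AroraBarakCC2009, Def. 8.6] -/
theorem transcriptAux_succ_true (r : List Bool) (P : IPProver) (k : ℕ) (t : List (List Bool)) :
    V.transcriptAux x r P m true (k + 1) t = V.transcriptAux x r P m false k (t ++ [V.vmsg x m r t]) :=
  rfl

/-- One step of the interaction, the prover speaking. [cite: AroraBarakCC2009, Def. 8.6] -/
theorem transcriptAux_succ_false (r : List Bool) (P : IPProver) (k : ℕ) (t : List (List Bool)) :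
    V.transcriptAux x r P m false (k + 1) t = V.transcriptAux x r P m true k (t ++ [(P t).takeD m false]) :=
  rfl

/-- No step left. [cite: AroraBarakCC2009, Def. 8.6] -/
theorem transcriptAux_zero_eq (r : List Bool) (P : IPProver) (b : Bool) (t : List (List Bool)) :
    V.transcriptAux x r P m b 0 t = t := by
  cases b <;> rfl

/-- **The interaction of `InteractiveProofs.lean` is the play of the game**: continuing a history
`h` (of vectors) for `n` messages against `P`, with the flag tracking the parity of `|h|`, gives
the play of the game against the strategy `stratOf P`, read as lists.
[cite: AroraBarakCC2009, Def. 8.6] -/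
theorem transcriptAux_eq_map_play (P : IPProver) (r : List.Vector Bool ℓ) :
    ∀ (n : ℕ) (b : Bool) (h : List (List.Vector Bool m)), (b = true ↔ Even h.length) →
      V.transcriptAux x r.toList P m b n (h.map List.Vector.toList) =
        ((V.game x m ℓ).play r (stratOf m P) n h).map List.Vector.toList
  | 0, b, h, _ => by rw [transcriptAux_zero_eq, PCGame.play_zero]
  | n + 1, true, h, hb => by
    have he : Even h.length := hb.1 rfl
    rw [transcriptAux_succ_true, PCGame.play_succ, if_pos he,
      ← transcriptAux_eq_map_play P r n false (h ++ [(V.game x m ℓ).next r h])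
        ⟨fun h' => absurd h' Bool.false_ne_true, fun h' => absurd h' (by simp [Nat.even_add_one, he])⟩]
    simp
  | n + 1, false, h, hb => by
    have ho : ¬Even h.length := fun h' => Bool.false_ne_true (hb.2 h')
    rw [transcriptAux_succ_false, PCGame.play_succ, if_neg ho,
      ← transcriptAux_eq_map_play P r n true (h ++ [stratOf m P h])
        ⟨fun _ => by simp [Nat.even_add_one, ho], fun _ => rfl⟩]
    simp [stratOf]

/-- **The complete transcript is the game's transcript.** [cite: AroraBarakCC2009, Def. 8.6] -/
theorem transcript_eq_map (k : ℕ) (r : List.Vector Bool (V.coins.eval x.length)) (P : IPProver) :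
    V.transcript k x r.toList P =
      ((V.game x (V.msgLen.eval x.length) (V.coins.eval x.length)).transcript k r
        (stratOf (V.msgLen.eval x.length) P)).map List.Vector.toList := by
  have h := V.transcriptAux_eq_map_play x (V.msgLen.eval x.length) (V.coins.eval x.length) P r k true []
    ⟨fun _ => by simp, fun _ => rfl⟩
  simpa [transcript, PCGame.transcript] using h

/-- **Acceptance of the interaction is the game's verdict on its transcript.**
[cite: AroraBarakCC2009, Def. 8.6] -/
theorem accepts_iff_game_accept (k : ℕ) (r : List.Vector Bool (V.coins.eval x.length)) (P : IPProver) :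
    V.Accepts k x r.toList P ↔
      (V.game x (V.msgLen.eval x.length) (V.coins.eval x.length)).accept r
        ((V.game x (V.msgLen.eval x.length) (V.coins.eval x.length)).transcript k r
          (stratOf (V.msgLen.eval x.length) P)) := by
  rw [Accepts, transcript_eq_map, game_accept_iff]

/-! ### The optimal acceptance probability -/

/-- **The optimal number of accepting coin strings** of `V` on input `x` in a `k`-message
interaction: the backward-induction value `PCGame.opt` of its game at the root.
[cite: AroraBarakCC2009, §8.1] -/
def optAccept (k : ℕ) (x : List Bool) : ℕ :=
  (V.game x (V.msgLen.eval x.length) (V.coins.eval x.length)).opt k []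

/-- The number of accepting coin strings against `P` is the game's count against `stratOf P`.
[cite: AroraBarakCC2009, Def. 8.6] -/
theorem cnt_accepts_eq (k : ℕ) (x : List Bool) (P : IPProver) :
    cnt (V.coins.eval x.length) {r | V.Accepts k x r P} =
      (univ.filter fun r : List.Vector Bool (V.coins.eval x.length) =>
        (V.game x (V.msgLen.eval x.length) (V.coins.eval x.length)).accept r
          ((V.game x (V.msgLen.eval x.length) (V.coins.eval x.length)).transcript k r
            (stratOf (V.msgLen.eval x.length) P))).card := by
  unfold cnt
  exact congrArg card (filter_congr fun r _ => V.accepts_iff_game_accept x k r P)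

/-- **No prover is accepted on more than `optAccept` coin strings.** [cite: AroraBarakCC2009, §8.1] -/
theorem cnt_accepts_le_optAccept (k : ℕ) (x : List Bool) (P : IPProver) :
    cnt (V.coins.eval x.length) {r | V.Accepts k x r P} ≤ V.optAccept k x := by
  rw [cnt_accepts_eq]
  exact PCGame.card_accept_transcript_le_opt _ _ k

/-- **The greedy strategy, played by an `IPProver`, is accepted on exactly `optAccept` coin
strings.** [cite: AroraBarakCC2009, §8.1] -/
theorem cnt_accepts_proverOf_greedy (k : ℕ) (x : List Bool) :
    cnt (V.coins.eval x.length) {r | V.Accepts k x r (proverOf (V.msgLen.eval x.length)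
      ((V.game x (V.msgLen.eval x.length) (V.coins.eval x.length)).greedy k))} = V.optAccept k x := by
  rw [cnt_accepts_eq, stratOf_proverOf]
  exact PCGame.card_accept_transcript_greedy _ k

/-- `optAccept ≤ 2^ℓ`. [folklore] -/
theorem optAccept_le_two_pow (k : ℕ) (x : List Bool) : V.optAccept k x ≤ 2 ^ V.coins.eval x.length := by
  rw [← cnt_accepts_proverOf_greedy]
  exact cnt_le _ _

/-- **Soundness reading**: against every prover, `Pr_r[V accepts] ≤ optAccept / 2^ℓ`.
[cite: AroraBarakCC2009, §8.1] -/
theorem acceptProb_le_optAccept_div (k : ℕ) (x : List Bool) (P : IPProver) :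
    V.acceptProb k x P ≤ (V.optAccept k x : ℝ) / 2 ^ V.coins.eval x.length := by
  unfold acceptProb
  rw [uniformProb_eq_cnt_div]
  exact div_le_div_of_nonneg_right (by exact_mod_cast V.cnt_accepts_le_optAccept k x P) (by positivity)

/-- **Completeness reading**: some prover is accepted with probability exactly `optAccept / 2^ℓ`,
so `optAccept / 2^ℓ = max_P Pr_r[V accepts x against P]`. [cite: AroraBarakCC2009, §8.1] -/
theorem exists_prover_acceptProb_eq (k : ℕ) (x : List Bool) :
    ∃ P : IPProver, V.acceptProb k x P = (V.optAccept k x : ℝ) / 2 ^ V.coins.eval x.length :=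
  ⟨_, by unfold acceptProb; rw [uniformProb_eq_cnt_div, cnt_accepts_proverOf_greedy]⟩

/-- If some prover is accepted with probability `≥ c` then `c · 2^ℓ ≤ optAccept`.
[cite: AroraBarakCC2009, §8.1] -/
theorem mul_two_pow_le_optAccept {k : ℕ} {x : List Bool} {P : IPProver} {c : ℝ}
    (h : c ≤ V.acceptProb k x P) : c * 2 ^ V.coins.eval x.length ≤ V.optAccept k x := by
  have h' := h.trans (V.acceptProb_le_optAccept_div k x P)
  rwa [le_div_iff₀ (by positivity)] at h'

/-- If every prover is accepted with probability `≤ s` then `optAccept ≤ s · 2^ℓ`.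
[cite: AroraBarakCC2009, §8.1] -/
theorem optAccept_le_mul_two_pow {k : ℕ} {x : List Bool} {s : ℝ}
    (h : ∀ P : IPProver, V.acceptProb k x P ≤ s) :
    (V.optAccept k x : ℝ) ≤ s * 2 ^ V.coins.eval x.length := by
  obtain ⟨P, hP⟩ := V.exists_prover_acceptProb_eq k x
  have h' := h P
  rwa [hP, div_le_iff₀ (by positivity)] at h'

end IPVerifier

end Literature.Computability.Complexity

end
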